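/-
Copyright: lit-balaban Phase-2 proof seat p27 (gen 36).  Statement-level skeleton of a published paper; no proof claims beyond what the
kernel checks below.
-/
import Literature.MathematicalPhysics.QuantumFieldTheory.BalabanImbrieJaffe1984to88.BIJ88FreeNeumannResolventRegionDeep
import Literature.MathematicalPhysics.QuantumFieldTheory.BalabanImbrieJaffe1984to88.BIJ88NeumannPropagatorSmallFieldSupDecay

/-!
# [BalabanImbrieJaffe1988] (2.30) p. 263 / [BalabanImbrieJaffe1985] §7.3 p. 326 / [6] (1.10) p. 573 — **THE `k`-UNIFORM SUP-NORM
# (OPERATOR-FORM) DECAY OF THE REGION NEUMANN PROPAGATORS `G_k(Ω,u)` OF A GENERAL BLOCK UNION `Ω` AT NON-FLAT SMALL FIELDS, AT DEEP ROWS: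
# `|(G_k(Ω,u)f)(x)| ≤ c₀(L^kε)²e^{−t₀dist_∞(x, supp f)/L^k}‖f‖_∞` for every `x` with `B_∞(x, 2L^k+1) ⊆ Ω`**
# — the deep-row member of front (α′) of `HOME/lit-balaban-r18/C2S14-CLOSURE.md` (operator-form (1.10) for general REGIONS at bondwise-small
# `u`), by p27 gen 34's route (Kato → comparison → Cauchy–Schwarz → Agmon) with the box chart REPLACED by p34's free Neumann Laplacian of the
# region (`BIJ88FreeNeumannLaplacianRegion`: `lapN`, minimum principle, comparison) and the free tilted row of the companion file
# `BIJ88FreeNeumannResolventRegionDeep` (`tilted_row_regionR_sq_le_deep`); §2: p31's binder shape (H1.10) and the bound in every gauge; §3: the same under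
# (7.3.1)-type plaquette smallness only (blockwise centred gauge, threshold in `(d, L^k)`).

T. Bałaban, J. Imbrie, A. Jaffe, *Effective action and cluster properties of the abelian Higgs model*, Commun. Math. Phys. **114** (1988)
257–315 [BalabanImbrieJaffe1988], Sect. 2 p. 262–263 [PDF 6–7], (2.27)/(2.30); [I] = T. Bałaban, J. Imbrie, A. Jaffe, *Renormalization of
the Higgs model: minimizers, propagators and the stability of mean field theory*, Commun. Math. Phys. **97** (1985) 299–329
[BalabanImbrieJaffe1985], (6.3.2) p. 320, §7.3 p. 326 [PDF 28]; [6] = [7] of [I] = T. Bałaban, *Regularity and decay of lattice Green's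
functions*, Commun. Math. Phys. **89** (1983) 571–597 [Balaban1983RegularityDecay], (1.10) p. 573, (2.44) p. 584.

statement-level skeleton of published theorems with citation tags; proofs where landed; nothing here is a claim about the Yang–Mills mass gap

PDF held: `paper:balaban1988-cmp114-bij-abelian-higgs-effective-action` (journal page = PDF page + 256), p. 262–263 [PDF 6–7];
`paper:balaban1985-cmp97-bij-higgs-minimizers` (journal page = PDF page + 298), p. 320 [PDF 22], p. 326 [PDF 28]; [6] (1.10) as transcribed
in the tree's `Balaban1983to89.B4Thm110ZeroTorus`.

CITATION HEADER (lean-in-tree rule).  Part of the lit-balaban TYPED SKELETON (HOME `run/shared/lean/pub/lit-balaban/`), PHASE-2 proof seat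
p27 gen 36 (unit `lit-balaban-p27-g36`; TAKING line HOME/STATUS.md 2026-08-23T05:39:10Z "B-deep", free-target protocol G.5-34(d): the
DEEP-ROW corollary-sized member of item B of p34 gen 18's (α′) TAKING 04:22:50Z — p34's every-`x` file B (on their Nash–Davies tilted row)
SUPERSEDES the present theorem in strength when it lands; the statements differ by the depth hypothesis, so neither restates the other).
WHAT IS REPRODUCED: located members of row **C2.Eq2.30** (`HOME/lit-balaban-r18/ROWS-C2.md`, owner r18) and of row **C1.Eq7.3.1-7.3.2**
(`HOME/lit-balaban-r15/ROWS-C1.md`, owner r15), for p31's CONSTRUCTED region propagators of record `gBox … Ω` on a GENERAL union of big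
blocks `Ω` AT NON-FLAT SMALL FIELDS, in the `k`-UNIFORM OPERATOR (`‖f‖_∞`) FORM, at the rows [6] keeps (`dist(x, Ω^c) ≥ R₀`).  No head
changes.  Kind «model-level theorems only» (no new definition, no `Prop`-valued fact).

THE PRINTED TEXT (verbatim).  C2 p. 262–263 [PDF 6–7]: *"In the scalar field sector, we have the η-lattice propagators G_k(Ω,u) defined on
subsets Ω ⊂ T_η with Neumann boundary conditions. … a straightforward application of the random walk expansion of [6] shows that
|(G_{k,loc}(u)f)(x)| ≦ ce^{−c dist(suppt f,x)}‖f‖_∞, (2.30)"*.  [I] p. 326 [PDF 28]: *"The propagators arising from Δ_k(u_k), under the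
restriction (7.3.1) on the gauge field, also satisfy the regularity and decay estimates of [7]."*  [6] (1.10) p. 573 (as transcribed in
`B4Thm110ZeroTorus`): *"|(D^η_{A,μ}G_k(Ω, A)f)(x)|, |(G_k(Ω, A)f)(x)| ≤ c₀exp(−δ₀ dist(x, supp f))‖f‖_∞ (1.10)"*, for *"x ∈ Ω"* with
*"dist({x,x′}, Ω^c) ≥ R₀"* — the VALUE member, general regions.

THE OBJECTS (all p31/p34/pv07, with bodies; nothing defined here).  A union `Ω` of `k`-blocks of the `ε`-torus (`IsBlockUnion k Ω`); its
Neumann propagator at the field `u`, `G_k(Ω,u) = gBox (α_k(a)L^{kd}) ε⁻¹ u k Ω` (p31 `BIJ88NeumannPropagator227Torus.gBox`: the inverse on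
`ℓ²(Ω)` of `N = (χ_ΩD_u)ᴴ(χ_ΩD_u) + α_kL^{kd}(Q_k(u)|_Ω)ᴴ(Q_k(u)|_Ω)`, extended by `0`); p34's small-field hypotheses on `Ω` (bondwise
`|u(b) − 1| ≤ T` on the intra-block bonds of `Ω^★`, `|u(Γ^{(k)}_y) − 1| ≤ δ` on `Ω`, `2(L^k−1)L^k·d·T² + 2δ² ≤ 1/2`); p34's free massive
Neumann resolvent `R_Ω = (L^{2k}·lapN Ω + 1)⁻¹` of the region (`BIJ88FreeNeumannLaplacianRegion`).

THE MECHANISM (p27 gen 34's `decay110_smallField_cube`, chart-free; STEPS 1–7 form the ROW KERNEL `decay110_smallField_region_row`, in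
which the tilted row `W` of STEP 5 is a hypothesis at the row `x`).  Fix `x`, put `φ = G_k(Ω,u)f`, `v = |φ|`.  (STEP 1–2) On `Ω`,
`Nφ = f` (p34 `nOp_mulVec_gBox_mulVec`); KATO'S INEQUALITY for the Neumann-cut covariant Laplacian (p27 `kato_region`) and the domination of
the covariant block term by the flat block average (`norm_gram_qMatK_region_mulVec_le`) give, at the points of `Ω`,
`ε^{−2}Σ_{b∈Ω^★, b∋y}(v(y) − v(y′)) + m₀v(y) ≤ g(y)`, `g = |f| + α_kQ_k^*Q_kv + m₀v`, `m₀ = (L^kε)^{−2}`.  (STEP 3–4) The bond sum IS p34's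
`(lapN Ω v)(y)` (`lapN_mulVec_apply`, letter for letter), so `(L^{2k}lapN Ω + 1)v ≤ (L^kε)²g` on `Ω`, and off `Ω` both `v` and the row of
`lapN Ω` vanish (`gBox_mulVec_eq_zero_of_not_mem`, `massOp_mulVec_apply_of_not_mem`); p34's COMPARISON PRINCIPLE `le_inv_massOp_mulVec`
gives `v(x) ≤ (L^kε)²Σ_yR_Ω(x,y)g(y)`.  (STEP 5) Cauchy–Schwarz with `w = e^{t|x−·|_∞/L^k}`: `v(x)² ≤ (L^kε)⁴·W·Σ_y(w(y)⁻¹g(y))²`,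
`W = Σ_y(w(y)R_Ω(x,y))² ≤ C₀L^{−kd}` THE TILTED ROW AT `x` — the kernel's hypothesis; supplied at deep rows by the companion file
(`tilted_row_regionR_sq_le_deep`: `B_∞(x,2L^k+1) ⊆ Ω`, `d ≤ 3`, odd `L`, `k ≤ K`), at every row by p34's file 3b when it lands.  (STEP 6–7) verbatim as in the cube file: `Σ(ωg)² ≤ 3(B + α_k²A_Q + m₀²A)`, `B ≤ F²K_tL^{kd}e^{−tD₀/L^k}`
(`sum_exp_neg_supDist_scale_le`), `A_Q ≤ e^{2t}A` (`tilted_sq_QQ_le`), `A ≤ (2(L^kε)²/μ₁)²B` (p34 `agmon_weighted_region` +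
`agmon_gap_region`), and the scalar assembly.

WHAT IS PROVED (theorems only; 0 `sorry`; standard axioms; no new definition, no `Prop`-valued fact).
* §1 (private `assembly_arith`), **`decay110_smallField_region_row`** (THE ROW KERNEL: the bound at every site `x` at which the free tilted
  row of `R_Ω` is supplied as a hypothesis — for p34's every-row supplier as much as for the companion file's deep rows; any `d`, `k ≤ m + K`),
  **`decay110_smallField_region_deep`** — for `d + 1 ≤ 3`, `ℓ ≥ 1`, `ℓ + 1` odd, `a > 0`: `∃ t₀, c₀ > 0`
  (from `d, ℓ, a`) such that for every `P` with `P.d = d+1`, `P.L = ℓ+1`, every `1 ≤ k ≤ K` with `4L^k + 6 ≤ |T|`, every block union `Ω`,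
  every `U(1)` field with p34's `(T, δ)` smallness on `Ω`, every `x` with `B_∞(x, 2L^k+1) ⊆ Ω`, every `f` with `|f| ≤ F` vanishing at
  sup-distance `< D₀` from `x`: `‖(G_k(Ω,u)f)(x)‖ ≤ c₀(L^kε)²e^{−t₀D₀/L^k}F`.
* §2 **`decay110_smallField_region_deep_input`** (p31's binder shape: `B5Ineq137Torus.T`, `(L^kε)²·(c₀e^{−δ₀(L^k)⁻¹D}F)`),
  **`decay110_smallField_region_deep_gaugeAct`** (the same for `u^h`, every gauge transformation `h`).
* §3 **`decay110_smallPlaquette_region_deep_uniform`** — the same bound under the PRINTED plaquette smallness (7.3.1)-type hypothesis ONLY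
  (`|u(∂p) − 1| ≤ θ` on the fine torus, `T ≥ d(L^k−1)θ`, `2(L^k−1)L^kDT² + 2(D(L^k−1)T)² ≤ 1/2`; no gauge condition, threshold in `(d, L^k)`
  only), by the blockwise centred gauge of gen 34 §7 (p30 `centredGauge`, p34 `holCK_congr`, p33 `norm_holCK_sub_one_le`, p31 `gBox_gaugeAct`).

HONEST SCOPE.  (i) The corollaries hold at DEEP ROWS ONLY (`B_∞(x, 2L^k+1) ⊆ Ω`); the every-row form = p34 gen 18's file B (supersedes;
it is one application of the row kernel `decay110_smallField_region_row` to their every-row tilted row).  (ii) `k ≤ K` (not `m + K`),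
`L` odd, `d + 1 ≤ 3` in the corollaries: from the torus pieces behind the companion tilted row (the row kernel has neither restriction).  (iii) §1–§2 take p34's bondwise `(T, δ)` conditions on `Ω`; §3 takes the
(7.3.1)-TYPE plaquette smallness of the FINE plaquettes of `u` (the printed (7.3.1) constrains the unit-lattice plaquettes of `v`; cf. gen 34
v1.3's HONEST SCOPE (iv)) with a threshold in `(d, L^k)`.  (iv) Constants existential, explicit in the proof (`t₀ = t/2`, `t = min(t₁, 1, μ₁/((2D+a)e))`, `c₀ = √(C₀C₂K_t)`), uniform in
`k`, `Ω`, the volume and the field.  (v) `set_option maxHeartbeats 800000` on §1's theorem.  DIVERGENCE OF METHOD from [6]'s random walk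
expansion as stated.  Nothing here is summit progress.  Unit `lit-balaban-p27` (literature-prover-lit-balaban-p27-g36-0), HOME
`run/shared/lean/pub/lit-balaban/`, 2026-08-23.
-/

open scoped BigOperators
open Finset Matrix

namespace Literature.MathematicalPhysics.QuantumFieldTheory.BalabanImbrieJaffe1984to88.BIJ88NeumannPropagatorSmallFieldRegionSupDecayDeep

open scoped ComplexConjugate
open Literature.MathematicalPhysics.QuantumFieldTheory.Balaban1983to89
open LatticeFieldCalculus (supDist)
open BIJ88Sect3Statements (U1 toC cfg starB mem_starB norm_toC)
open BIJ85BlockAveragesTorus BIJ85BlockAveragesTorusK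
open BIJ88NeumannNoZeroModesTorus (IsBlockUnion)
open BIJ88NeumannPropagator227Torus (nOp gBox dN qMatK proj nOp_eq qMatK_apply qMatK_mulVec proj_mulVec)
open BIJ88NeumannPropagatorSmallFieldRegion (agmon_weighted_region agmon_gap_region weight_bond_osc_sq weight_block_osc_sq
  nOp_mulVec_gBox_mulVec gBox_mulVec_eq_zero_of_not_mem)
open BIJ85FreeResolventTorus (towerQQ_mulVec_apply tilted_sq_QQ_le weight_block_osc)
open BIJ85FreeResolventTiltedRow (sum_exp_neg_supDist_scale_le)
open BIJ88NeumannPropagatorSmallFieldSupDecay (kato_region norm_gram_qMatK_region_mulVec_le)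
open BIJ88FreeNeumannLaplacianRegion (lapN lapN_mulVec_apply massOp_mulVec_apply massOp_mulVec_apply_of_not_mem le_inv_massOp_mulVec)
open BIJ88FreeNeumannResolventRegionDeep (tilted_row_regionR_sq_le_deep)

noncomputable section

variable {P : Params}

/-! ## §1 The (1.10)-value member in OPERATOR FORM for the region propagators `G_k(Ω,u)` at NON-FLAT small fields, `k`-uniform, deep rows:
`|(G_k(Ω,u)f)(x)| ≤ c₀(L^kε)²e^{−t₀·dist_∞(x, supp f)/L^k}‖f‖_∞` -/

section Assembly

/-- kernel (the scalar assembly, p27 gen 32/34's bookkeeping verbatim): from `|φ(x)|² ≤ W·G₂` (Cauchy–Schwarz), the tilted row bound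
`W ≤ C₀(L^kε)⁴L^{−kD}`, the split `G₂ ≤ 3(B + α²A_Q + m²A)`, the block bound `A_Q ≤ e^{2t}A`, the Agmon bound `A ≤ (2(L^kε)²/μ)²B`,
`α(L^kε)² = a_k ≤ a`, `m(L^kε)² = 1` and the support bound `B ≤ F²E²KL^{kD}` to `|φ(x)| ≤ √(C₀C₂K)(L^kε)²EF`. [folklore] -/
private theorem assembly_arith {vx W G₂ A A_Q B C₀ sp N F E K α m aS a μ₀ e₂ eₜ : ℝ}
    (hv2 : vx ^ 2 ≤ W * G₂) (hW : W ≤ C₀ * (sp ^ 4 / N)) (hN : 0 < N) (hC₀ : 0 ≤ C₀)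
    (hG₂ : G₂ ≤ 3 * (B + α ^ 2 * A_Q + m ^ 2 * A)) (hG₂nn : 0 ≤ G₂) (hAQ : A_Q ≤ eₜ * A) (heₜ0 : 0 ≤ eₜ) (heₜ : eₜ ≤ e₂)
    (hA : A ≤ (2 * sp ^ 2 / μ₀) ^ 2 * B) (hB0 : 0 ≤ B) (hμ₀ : 0 < μ₀) (hαsp : α * sp ^ 2 = aS) (haS0 : 0 ≤ aS) (haS : aS ≤ a)
    (hmsp : m * sp ^ 2 = 1) (hB : B ≤ F ^ 2 * E ^ 2 * (K * N)) (hE : 0 ≤ E) (hK : 0 ≤ K) (hF : 0 ≤ F) :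
    vx ≤ Real.sqrt (C₀ * (3 * (1 + 4 * (a ^ 2 * e₂ + 1) / μ₀ ^ 2)) * K) * sp ^ 2 * E * F := by
  have he₂ : 0 ≤ e₂ := heₜ0.trans heₜ
  have hae₂ : 0 ≤ a ^ 2 * e₂ := mul_nonneg (sq_nonneg a) he₂
  set C₂ : ℝ := 3 * (1 + 4 * (a ^ 2 * e₂ + 1) / μ₀ ^ 2) with hC₂
  have hC₂nn : 0 ≤ C₂ := by positivity
  have hcoef : (α ^ 2 * eₜ + m ^ 2) * (2 * sp ^ 2 / μ₀) ^ 2 = 4 * ((α * sp ^ 2) ^ 2 * eₜ + (m * sp ^ 2) ^ 2) / μ₀ ^ 2 := by ring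
  rw [hαsp, hmsp, one_pow] at hcoef
  have haS2 : aS ^ 2 * eₜ ≤ a ^ 2 * e₂ :=
    (mul_le_mul_of_nonneg_right (pow_le_pow_left₀ haS0 haS 2) heₜ0).trans (mul_le_mul_of_nonneg_left heₜ (sq_nonneg a))
  have hcoef_le : (α ^ 2 * eₜ + m ^ 2) * (2 * sp ^ 2 / μ₀) ^ 2 ≤ 4 * (a ^ 2 * e₂ + 1) / μ₀ ^ 2 := by
    rw [hcoef]
    exact div_le_div_of_nonneg_right (by linarith) (sq_nonneg _)
  have hG₂' : G₂ ≤ C₂ * B := by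
    have h1 : α ^ 2 * A_Q ≤ α ^ 2 * (eₜ * A) := mul_le_mul_of_nonneg_left hAQ (sq_nonneg _)
    have h2 : (α ^ 2 * eₜ + m ^ 2) * A ≤ (α ^ 2 * eₜ + m ^ 2) * ((2 * sp ^ 2 / μ₀) ^ 2 * B) :=
      mul_le_mul_of_nonneg_left hA (by positivity)
    have h3 : (α ^ 2 * eₜ + m ^ 2) * (2 * sp ^ 2 / μ₀) ^ 2 * B ≤ 4 * (a ^ 2 * e₂ + 1) / μ₀ ^ 2 * B :=
      mul_le_mul_of_nonneg_right hcoef_le hB0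
    calc G₂ ≤ 3 * (B + α ^ 2 * A_Q + m ^ 2 * A) := hG₂
      _ ≤ 3 * (B + (α ^ 2 * eₜ + m ^ 2) * ((2 * sp ^ 2 / μ₀) ^ 2 * B)) := by linarith
      _ = 3 * (B + (α ^ 2 * eₜ + m ^ 2) * (2 * sp ^ 2 / μ₀) ^ 2 * B) := by ring
      _ ≤ 3 * (B + 4 * (a ^ 2 * e₂ + 1) / μ₀ ^ 2 * B) := by linarith
      _ = C₂ * B := by rw [hC₂]; ring
  have hsq : vx ^ 2 ≤ (Real.sqrt (C₀ * C₂ * K) * sp ^ 2 * E * F) ^ 2 := by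
    have h1 : W * G₂ ≤ C₀ * (sp ^ 4 / N) * (C₂ * B) := mul_le_mul hW hG₂' hG₂nn (by positivity)
    have h2 : C₀ * (sp ^ 4 / N) * (C₂ * B) ≤ C₀ * (sp ^ 4 / N) * (C₂ * (F ^ 2 * E ^ 2 * (K * N))) :=
      mul_le_mul_of_nonneg_left (mul_le_mul_of_nonneg_left hB hC₂nn) (by positivity)
    have h3 : C₀ * (sp ^ 4 / N) * (C₂ * (F ^ 2 * E ^ 2 * (K * N))) = (Real.sqrt (C₀ * C₂ * K) * sp ^ 2 * E * F) ^ 2 := by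
      rw [mul_pow, mul_pow, mul_pow, Real.sq_sqrt (by positivity)]
      field_simp
    linarith
  exact le_of_pow_le_pow_left₀ two_ne_zero (by positivity) hsq

set_option maxHeartbeats 800000 in
/-- **THE ROW KERNEL OF THE SUP-NORM ROUTE FOR A GENERAL BLOCK UNION `Ω`** (p27 gen 34's §4, chart-free, the free tilted row taken as a
ROW HYPOTHESIS so that every supplier of tilted rows — the companion deep-row file, p34's every-row Nash–Davies file — closes (1.10) at its
rows by one application): there are `t₀, c₀ > 0` depending on `(d, a, t₁, C₀)` only such that for every volume with `P.d = d + 1`, every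
`1 ≤ k ≤ m + K`, every union `Ω` of `k`-blocks, every `U(1)` field with p34's `(T, δ)` smallness on `Ω`, every site `x` AT WHICH THE FREE
TILTED ROW HOLDS (`Σ_z(e^{t|x−z|_∞/L^k}R_Ω(x,z))² ≤ C₀L^{−kD}` for all `0 ≤ t ≤ t₁`, `R_Ω = (L^{2k}lapN Ω + 1)⁻¹`), and every source `f` with
`|f| ≤ F` vanishing at sup-distance `< D₀` from `x`: `‖(G_k(Ω,u)f)(x)‖ ≤ c₀(L^kε)²e^{−t₀D₀/L^k}F`.  Kato on the region → p34's `lapN` and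
comparison principle → Cauchy–Schwarz with the row hypothesis → the block / source / Agmon pieces → scalar assembly (THE MECHANISM above).
[cite: BalabanImbrieJaffe1988, (2.30) p.263] -/
theorem decay110_smallField_region_row (d : ℕ) {a t₁ C₀ : ℝ} (ha : 0 < a) (ht₁ : 0 < t₁) (hC₀ : 0 < C₀) :
    ∃ t₀ c₀ : ℝ, 0 < t₀ ∧ 0 < c₀ ∧ ∀ (P : Params), P.d = d + 1 →
      ∀ k : ℕ, 1 ≤ k → k ≤ P.m + P.K →
      ∀ (Ω : Finset (Balaban1983to89.Site P 0)), IsBlockUnion k Ω →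
        ∀ (U : GaugeField P 0 U1) (T δ : ℝ),
          (∀ b ∈ starB Ω, blkIter k b.src = blkIter k b.tgt → ‖toC (U b) - 1‖ ≤ T) →
          (∀ y ∈ Ω, ‖holCK U k y - 1‖ ≤ δ) →
          2 * (((P.L : ℝ) ^ k - 1) * (P.L : ℝ) ^ k) * P.d * T ^ 2 + 2 * δ ^ 2 ≤ 1 / 2 →
          ∀ (x : Balaban1983to89.Site P 0),
            (∀ t : ℝ, 0 ≤ t → t ≤ t₁ →
              ∑ z, (Real.exp (t * (supDist x z : ℝ) / (P.L : ℝ) ^ k) * ((((P.L : ℝ) ^ k) ^ 2) • lapN Ω + 1)⁻¹ x z) ^ 2 ≤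
                C₀ / (P.L : ℝ) ^ (k * P.d)) →
          ∀ (f : Balaban1983to89.Site P 0 → ℂ) (F D₀ : ℝ),
            (∀ z, ‖f z‖ ≤ F) → (∀ z, f z ≠ 0 → D₀ ≤ (supDist x z : ℝ)) →
            ‖(gBox (B1RG242Torus.α P a k * (P.L : ℝ) ^ (k * P.d)) P.eps⁻¹ U k Ω *ᵥ f) x‖
              ≤ c₀ * P.spacing k ^ 2 * Real.exp (-(t₀ * D₀ / (P.L : ℝ) ^ k)) * F := by
  set μ₁ : ℝ := min (1 / 4) (a / 8) with hμ₁
  have hμ₁pos : 0 < μ₁ := lt_min (by norm_num) (by positivity)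
  set t : ℝ := min (min t₁ 1) (μ₁ / ((2 * ((d + 1 : ℕ) : ℝ) + a) * Real.exp 1)) with htdef
  have htpos : 0 < t := lt_min (lt_min ht₁ one_pos) (by positivity)
  have ht₁' : t ≤ t₁ := (min_le_left _ _).trans (min_le_left _ _)
  have ht1 : t ≤ 1 := (min_le_left _ _).trans (min_le_right _ _)
  have htμ' : t ≤ μ₁ / ((2 * ((d + 1 : ℕ) : ℝ) + a) * Real.exp 1) := min_le_right _ _
  set Kt : ℝ := (2 * (1 + ((d + 1 : ℕ) : ℝ) / t)) ^ (d + 1) with hKt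
  have hKtpos : 0 < Kt := by positivity
  set C₂ : ℝ := 3 * (1 + 4 * (a ^ 2 * Real.exp 2 + 1) / μ₁ ^ 2) with hC₂
  have hC₂pos : 0 < C₂ := by positivity
  refine ⟨t / 2, Real.sqrt (C₀ * C₂ * Kt), by positivity, Real.sqrt_pos.2 (by positivity), ?_⟩
  intro P hPd k hk1 hk Ω hΩ U T δ hInt hTree hsmall x hrow f F D₀ hF hsupp
  -- the free tilted row of `R_Ω` at the row `x` (hypothesis)
  have hW0 := hrow t htpos.le ht₁'
  have hk0 : 0 + k ≤ P.m + P.K := by omega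
  have hLpos : (0 : ℝ) < P.L := P.cast_L_pos
  have hL1 : (1 : ℝ) < P.L := B1RG242Torus.one_lt_cast_L P
  have hnr : 0 < (P.L : ℝ) ^ k := pow_pos hLpos k
  have hN' : 0 < ((P.L : ℝ) ^ k) ^ (d + 1) := pow_pos hnr _
  have hNeq : (P.L : ℝ) ^ (k * P.d) = ((P.L : ℝ) ^ k) ^ (d + 1) := by rw [hPd, pow_mul]
  have hεpos : 0 < P.eps := P.eps_pos
  have hsp : 0 < P.spacing k := P.spacing_pos k
  have hspdef : P.spacing k = (P.L : ℝ) ^ k * P.eps := rfl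
  have hF0 : 0 ≤ F := (norm_nonneg _).trans (hF x)
  have hα : 0 < B1RG242Torus.α P a k := mul_pos (B1.aSeq_pos ha hL1 hk1) (inv_pos.2 (pow_pos hsp 2))
  have hNd : 0 < (P.L : ℝ) ^ (k * P.d) := pow_pos hLpos _
  have ha' : 0 < B1RG242Torus.α P a k * (P.L : ℝ) ^ (k * P.d) := mul_pos hα hNd
  have hc : P.eps⁻¹ ≠ 0 := inv_ne_zero hεpos.ne'
  have hm : 0 < (P.spacing k ^ 2)⁻¹ := inv_pos.2 (pow_pos hsp 2)
  have hαdef : B1RG242Torus.α P a k = B1.aSeq a P.L k * (P.spacing k ^ 2)⁻¹ := rfl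
  have hs0 : (0 : ℝ) ≤ ((P.L : ℝ) ^ k) ^ 2 := sq_nonneg _
  -- the objects
  set α₀ : ℝ := B1RG242Torus.α P a k with hα₀
  set m₀ : ℝ := (P.spacing k ^ 2)⁻¹ with hm₀
  set a' : ℝ := α₀ * (P.L : ℝ) ^ (k * P.d) with ha'def
  set φ : Balaban1983to89.Site P 0 → ℂ := gBox a' P.eps⁻¹ U k Ω *ᵥ f with hφ
  set v : Balaban1983to89.Site P 0 → ℝ := fun z => ‖φ z‖ with hv
  set QQ : Matrix (Balaban1983to89.Site P 0) (Balaban1983to89.Site P 0) ℝ := B1RG242Torus.Qks P k * B1RG242Torus.Qk P k with hQQ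
  set ω : Balaban1983to89.Site P 0 → ℝ := fun z => Real.exp ((-t) * (supDist x z : ℝ) / (P.L : ℝ) ^ k) with hω
  set w : Balaban1983to89.Site P 0 → ℝ := fun z => Real.exp (t * (supDist x z : ℝ) / (P.L : ℝ) ^ k) with hw
  set R : Matrix (Balaban1983to89.Site P 0) (Balaban1983to89.Site P 0) ℝ := ((((P.L : ℝ) ^ k) ^ 2) • lapN Ω + 1)⁻¹ with hRdef
  set g : Balaban1983to89.Site P 0 → ℝ := fun z => ‖f z‖ + α₀ * (QQ *ᵥ v) z + m₀ * v z with hg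
  have hωpos : ∀ z, 0 < ω z := fun z => Real.exp_pos _
  have hwpos : ∀ z, 0 < w z := fun z => Real.exp_pos _
  have hvnn : ∀ z, 0 ≤ v z := fun z => norm_nonneg _
  have hQQnn : ∀ z, 0 ≤ (QQ *ᵥ v) z := fun z => by
    rw [hQQ, towerQQ_mulVec_apply hk]; exact mul_nonneg (by positivity) (sum_nonneg fun _ _ => hvnn _)
  have hgnn : ∀ z, 0 ≤ g z := fun z => by
    simp only [hg]; exact add_nonneg (add_nonneg (norm_nonneg _) (mul_nonneg hα.le (hQQnn z))) (mul_nonneg hm.le (hvnn z))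
  -- STEP 1: the equation on the region, `(χD_u)ᴴ(χD_u)φ = f − a′(Q_k|_Ω)ᴴ(Q_k|_Ω)φ` at the points of `Ω`
  have heq : nOp a' P.eps⁻¹ U k Ω *ᵥ φ = proj Ω *ᵥ f := nOp_mulVec_gBox_mulVec hk0 hc ha' U hΩ f
  have hDD : ∀ y ∈ Ω, (((dN P.eps⁻¹ U Ω)ᴴ * dN P.eps⁻¹ U Ω) *ᵥ φ) y = f y - (a' : ℂ) * (((qMatK U k Ω)ᴴ * qMatK U k Ω) *ᵥ φ) y := by
    intro y hy
    have h := congr_fun heq y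
    rw [nOp_eq, add_mulVec, smul_mulVec, Pi.add_apply, Pi.smul_apply, smul_eq_mul, proj_mulVec, if_pos hy] at h
    linear_combination h
  -- STEP 2: Kato on the region, `ε⁻²Σ_μ(in-region differences of |φ|) + m₀|φ| ≤ g` at the points of `Ω`
  have hKato : ∀ y ∈ Ω, (P.eps⁻¹) ^ 2 * (∑ μ : Fin P.d,
      ((if (⟨y, μ⟩ : PBond P 0) ∈ starB Ω then v y - v (y.shift μ) else 0) +
        (if (⟨y.unshift μ, μ⟩ : PBond P 0) ∈ starB Ω then v y - v (y.unshift μ) else 0))) + m₀ * v y ≤ g y := by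
    intro y hy
    refine (kato_region P.eps⁻¹ m₀ U Ω φ y).trans ?_
    rw [hDD y hy]
    have hX := norm_gram_qMatK_region_mulVec_le hk U Ω φ y
    have h1 : ‖(a' : ℂ) * (((qMatK U k Ω)ᴴ * qMatK U k Ω) *ᵥ φ) y‖ ≤ α₀ * (QQ *ᵥ v) y := by
      rw [norm_mul, Complex.norm_real, Real.norm_of_nonneg ha'.le]
      refine (mul_le_mul_of_nonneg_left hX ha'.le).trans (le_of_eq ?_)
      rw [ha'def, mul_assoc, mul_inv_cancel_left₀ hNd.ne']
    have h2 : ‖((m₀ : ℝ) : ℂ) * φ y‖ = m₀ * v y := by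
      rw [norm_mul, Complex.norm_real, Real.norm_of_nonneg hm.le]
    calc ‖f y - (a' : ℂ) * (((qMatK U k Ω)ᴴ * qMatK U k Ω) *ᵥ φ) y + ((m₀ : ℝ) : ℂ) * φ y‖
        ≤ ‖f y - (a' : ℂ) * (((qMatK U k Ω)ᴴ * qMatK U k Ω) *ᵥ φ) y‖ + ‖((m₀ : ℝ) : ℂ) * φ y‖ := norm_add_le _ _
      _ ≤ ‖f y‖ + ‖(a' : ℂ) * (((qMatK U k Ω)ᴴ * qMatK U k Ω) *ᵥ φ) y‖ + ‖((m₀ : ℝ) : ℂ) * φ y‖ :=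
          add_le_add (norm_sub_le _ _) le_rfl
      _ ≤ g y := by rw [h2]; simp only [hg]; linarith [h1]
  -- STEP 3: p34's massive operator, `(L^{2k}lapN Ω + 1)v ≤ (L^kε)²·g` everywhere (the Kato sum IS `lapN Ω v` on `Ω`; off `Ω` both sides' rows
  -- are trivial)
  have hM : ∀ y, (((((P.L : ℝ) ^ k) ^ 2) • lapN Ω + 1) *ᵥ v) y ≤ P.spacing k ^ 2 * g y := by
    intro y
    by_cases hy : y ∈ Ω
    · have hK := hKato y hy
      rw [massOp_mulVec_apply, lapN_mulVec_apply]
      set S : ℝ := ∑ μ : Fin P.d, ((if (⟨y, μ⟩ : PBond P 0) ∈ starB Ω then v y - v (y.shift μ) else 0) +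
        (if (⟨y.unshift μ, μ⟩ : PBond P 0) ∈ starB Ω then v y - v (y.unshift μ) else 0)) with hSdef
      have e : ((P.L : ℝ) ^ k) ^ 2 * S + v y = P.spacing k ^ 2 * ((P.eps⁻¹) ^ 2 * S + m₀ * v y) := by
        rw [hm₀, hspdef]; field_simp
      rw [e]
      exact mul_le_mul_of_nonneg_left hK (pow_pos hsp 2).le
    · rw [massOp_mulVec_apply_of_not_mem _ Ω v hy]
      have hvy : v y = 0 := by
        simp only [hv, hφ]
        rw [gBox_mulVec_eq_zero_of_not_mem hk0 hc ha' U hΩ f hy, norm_zero]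
      rw [hvy]
      exact mul_nonneg (pow_pos hsp 2).le (hgnn y)
  -- STEP 4: p34's comparison principle, `|φ(x)| ≤ (R_Ω((L^kε)²g))(x) = Σ_y R_Ω(x,y)(L^kε)²g(y)`
  have hvx : v x ≤ ∑ y, R x y * (P.spacing k ^ 2 * g y) := by
    have h := le_inv_massOp_mulVec hs0 Ω (g := fun y => P.spacing k ^ 2 * g y) hM x
    simpa only [hRdef, mulVec, dotProduct] using h
  -- STEP 5: Cauchy–Schwarz with the weight `w = e^{t|x−·|_∞/L^k}`, `w⁻¹ = ω`
  have hCS : (∑ y, R x y * (P.spacing k ^ 2 * g y)) ^ 2 ≤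
      (∑ y, (w y * R x y) ^ 2) * ∑ y, ((w y)⁻¹ * (P.spacing k ^ 2 * g y)) ^ 2 := by
    have e : ∑ y, R x y * (P.spacing k ^ 2 * g y) = ∑ y, (w y * R x y) * ((w y)⁻¹ * (P.spacing k ^ 2 * g y)) :=
      sum_congr rfl fun y _ => by
        rw [show w y * R x y * ((w y)⁻¹ * (P.spacing k ^ 2 * g y)) = (w y * (w y)⁻¹) * (R x y * (P.spacing k ^ 2 * g y)) by ring,
          mul_inv_cancel₀ (hwpos y).ne', one_mul]
    rw [e]
    exact sum_mul_sq_le_sq_mul_sq _ _ _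
  -- the deep-row tilted row of `R_Ω` (companion file)
  have hW : ∑ y, (w y * R x y) ^ 2 ≤ C₀ / ((P.L : ℝ) ^ k) ^ (d + 1) := by
    rw [← hNeq]; exact hW0
  -- the source side: `Σ_y (w(y)⁻¹(L^kε)²g(y))² = (L^kε)⁴·Σ_y(ω(y)g(y))²`
  have hwinv : ∀ y, (w y)⁻¹ = ω y := fun y => by
    simp only [hw, hω]
    rw [← Real.exp_neg]
    congr 1; ring
  have hG2 : ∑ y, ((w y)⁻¹ * (P.spacing k ^ 2 * g y)) ^ 2 = P.spacing k ^ 4 * ∑ y, (ω y * g y) ^ 2 := by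
    rw [mul_sum]
    exact sum_congr rfl fun y _ => by rw [hwinv y]; ring
  have hv2 : v x ^ 2 ≤ (C₀ * (P.spacing k ^ 4 / ((P.L : ℝ) ^ k) ^ (d + 1))) * ∑ y, (ω y * g y) ^ 2 := by
    calc v x ^ 2 ≤ (∑ y, R x y * (P.spacing k ^ 2 * g y)) ^ 2 := pow_le_pow_left₀ (hvnn x) hvx 2
      _ ≤ (∑ y, (w y * R x y) ^ 2) * ∑ y, ((w y)⁻¹ * (P.spacing k ^ 2 * g y)) ^ 2 := hCS
      _ ≤ (C₀ / ((P.L : ℝ) ^ k) ^ (d + 1)) * (P.spacing k ^ 4 * ∑ y, (ω y * g y) ^ 2) := by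
          rw [hG2]
          exact mul_le_mul_of_nonneg_right hW (mul_nonneg (by positivity) (sum_nonneg fun _ _ => sq_nonneg _))
      _ = (C₀ * (P.spacing k ^ 4 / ((P.L : ℝ) ^ k) ^ (d + 1))) * ∑ y, (ω y * g y) ^ 2 := by ring
  -- STEP 6: the three pieces of `Σ_z(ω(z)g(z))²`
  set A : ℝ := ∑ z, (ω z * v z) ^ 2 with hA
  set AQ : ℝ := ∑ z, (ω z * (QQ *ᵥ v) z) ^ 2 with hAQ
  set B : ℝ := ∑ z, (ω z * ‖f z‖) ^ 2 with hB
  have hB0 : 0 ≤ B := sum_nonneg fun z _ => sq_nonneg _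
  have hG₂ : ∑ z, (ω z * g z) ^ 2 ≤ 3 * (B + α₀ ^ 2 * AQ + m₀ ^ 2 * A) := by
    have h3 : ∀ p q r : ℝ, (p + q + r) ^ 2 ≤ 3 * p ^ 2 + 3 * q ^ 2 + 3 * r ^ 2 := fun p q r => by
      nlinarith [sq_nonneg (p - q), sq_nonneg (q - r), sq_nonneg (p - r)]
    calc ∑ z, (ω z * g z) ^ 2
        ≤ ∑ z, (3 * (ω z * ‖f z‖) ^ 2 + 3 * α₀ ^ 2 * (ω z * (QQ *ᵥ v) z) ^ 2 + 3 * m₀ ^ 2 * (ω z * v z) ^ 2) :=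
          sum_le_sum fun z _ => by
            have e : ω z * g z = ω z * ‖f z‖ + α₀ * (ω z * (QQ *ᵥ v) z) + m₀ * (ω z * v z) := by
              simp only [hg]; ring
            rw [e]
            refine (h3 _ _ _).trans (le_of_eq ?_)
            ring
      _ = 3 * (B + α₀ ^ 2 * AQ + m₀ ^ 2 * A) := by
          rw [sum_add_distrib, sum_add_distrib, ← mul_sum, ← mul_sum, ← mul_sum, hB, hAQ, hA]
          ring
  -- (6a) the block piece: `A_Q ≤ e^{2t}A`
  have hoscω : ∀ z z' : Balaban1983to89.Site P 0,
      Balaban1983to89.Site.proj k k z' = Balaban1983to89.Site.proj k k z → ω z ≤ Real.exp t * ω z' := by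
    intro z z' hzz
    have h1 := weight_block_osc htpos.le hk x z' z hzz.symm
    rw [← Real.exp_add, Real.exp_le_exp] at h1
    show Real.exp _ ≤ Real.exp t * Real.exp _
    rw [← Real.exp_add, Real.exp_le_exp]
    have e1' : (-t) * (supDist x z : ℝ) / (P.L : ℝ) ^ k = -(t * (supDist x z : ℝ) / (P.L : ℝ) ^ k) := by ring
    have e2' : (-t) * (supDist x z' : ℝ) / (P.L : ℝ) ^ k = -(t * (supDist x z' : ℝ) / (P.L : ℝ) ^ k) := by ring
    rw [e1', e2']
    linarith
  have hAQle : AQ ≤ Real.exp (2 * t) * A := tilted_sq_QQ_le hk hωpos hoscω v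
  -- (6b) the source piece: `B ≤ F²e^{−tD₀/L^k}·K_tL^{kD}`
  have hBle : B ≤ F ^ 2 * Real.exp (-(t / 2 * D₀ / (P.L : ℝ) ^ k)) ^ 2 * (Kt * ((P.L : ℝ) ^ k) ^ (d + 1)) := by
    have hE : Real.exp (-(t / 2 * D₀ / (P.L : ℝ) ^ k)) ^ 2 = Real.exp (-(t * D₀ / (P.L : ℝ) ^ k)) := by
      rw [sq, ← Real.exp_add]; congr 1; ring
    rw [hE]
    have hpt : ∀ z, (ω z * ‖f z‖) ^ 2 ≤ F ^ 2 * Real.exp (-(t * D₀ / (P.L : ℝ) ^ k)) * ω z := by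
      intro z
      by_cases hz : f z = 0
      · rw [hz, norm_zero, mul_zero, sq, zero_mul]
        exact mul_nonneg (mul_nonneg (sq_nonneg _) (Real.exp_pos _).le) (hωpos z).le
      · have hDz := hsupp z hz
        have hω2 : ω z ^ 2 ≤ Real.exp (-(t * D₀ / (P.L : ℝ) ^ k)) * ω z := by
          show Real.exp _ ^ 2 ≤ Real.exp _ * Real.exp _
          rw [sq, ← Real.exp_add, ← Real.exp_add, Real.exp_le_exp]
          have : t * D₀ / (P.L : ℝ) ^ k ≤ t * (supDist x z : ℝ) / (P.L : ℝ) ^ k :=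
            div_le_div_of_nonneg_right (mul_le_mul_of_nonneg_left hDz htpos.le) hnr.le
          have e1' : (-t) * (supDist x z : ℝ) / (P.L : ℝ) ^ k = -(t * (supDist x z : ℝ) / (P.L : ℝ) ^ k) := by ring
          rw [e1']
          linarith
        have hf2 : ‖f z‖ ^ 2 ≤ F ^ 2 := pow_le_pow_left₀ (norm_nonneg _) (hF z) 2
        calc (ω z * ‖f z‖) ^ 2 = ω z ^ 2 * ‖f z‖ ^ 2 := mul_pow _ _ _
          _ ≤ (Real.exp (-(t * D₀ / (P.L : ℝ) ^ k)) * ω z) * F ^ 2 :=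
              mul_le_mul hω2 hf2 (sq_nonneg _) (mul_nonneg (Real.exp_pos _).le (hωpos z).le)
          _ = F ^ 2 * Real.exp (-(t * D₀ / (P.L : ℝ) ^ k)) * ω z := by ring
    have hsumω : ∑ z, ω z ≤ Kt * ((P.L : ℝ) ^ k) ^ (d + 1) := by
      have h := sum_exp_neg_supDist_scale_le (P := P) htpos k x
      rw [hPd] at h
      have e : ∀ z, ω z = Real.exp (-(t * (supDist x z : ℝ) / (P.L : ℝ) ^ k)) := fun z => by
        simp only [hω]; congr 1; ring
      simp_rw [e]
      exact h
    calc B = ∑ z, (ω z * ‖f z‖) ^ 2 := hB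
      _ ≤ ∑ z, F ^ 2 * Real.exp (-(t * D₀ / (P.L : ℝ) ^ k)) * ω z := sum_le_sum fun z _ => hpt z
      _ = F ^ 2 * Real.exp (-(t * D₀ / (P.L : ℝ) ^ k)) * ∑ z, ω z := by rw [mul_sum]
      _ ≤ F ^ 2 * Real.exp (-(t * D₀ / (P.L : ℝ) ^ k)) * (Kt * ((P.L : ℝ) ^ k) ^ (d + 1)) :=
          mul_le_mul_of_nonneg_left hsumω (by positivity)
  -- (6c) the Agmon piece on the region (p34): `A ≤ (2(L^kε)²/μ₁)²B`
  have hAle : A ≤ (2 * P.spacing k ^ 2 / μ₁) ^ 2 * B := by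
    have hst : |(-t)| ≤ t := by rw [abs_neg, abs_of_pos htpos]
    have hω₁ : ∀ b ∈ starB Ω, (ω b.tgt - ω b.src) ^ 2 ≤
        ((t / (P.L : ℝ) ^ k) ^ 2 * Real.exp (t / (P.L : ℝ) ^ k)) * (ω b.tgt * ω b.src) := fun b _ => weight_bond_osc_sq hst k x b
    have hω₂ : ∀ z z' : Balaban1983to89.Site P 0, blkIter k z = blkIter k z' →
        (ω z - ω z') ^ 2 ≤ (t ^ 2 * Real.exp t) * (ω z * ω z') := fun z z' hzz => weight_block_osc_sq hst hk0 x z z' hzz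
    have htμ : t ≤ min (1 / 4) (a / 8) / ((2 * P.d + a) * Real.exp 1) := by
      rw [hPd]; exact htμ'
    have hge := agmon_gap_region P ha hk1 htpos.le ht1 htμ
    have hν : 0 < μ₁ / (2 * P.spacing k ^ 2) := by positivity
    have hκ := sub_pos.1 (lt_of_lt_of_le hν hge)
    have hAg := agmon_weighted_region hk0 hΩ U hInt hTree hsmall hc ha' hωpos (by positivity) (by positivity) hω₁ hω₂ hκ f
    have hAg' : A ≤ B / (μ₁ / (2 * P.spacing k ^ 2)) ^ 2 := by
      refine hAg.trans (div_le_div_of_nonneg_left hB0 (pow_pos hν 2) ?_)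
      exact pow_le_pow_left₀ hν.le hge 2
    refine hAg'.trans (le_of_eq ?_)
    field_simp
  -- STEP 7: the scalar assembly
  have hαsp : α₀ * P.spacing k ^ 2 = B1.aSeq a P.L k := by
    rw [hαdef, hm₀, inv_mul_cancel_right₀ (pow_pos hsp 2).ne']
  have hmsp : m₀ * P.spacing k ^ 2 = 1 := by rw [hm₀]; exact inv_mul_cancel₀ (pow_pos hsp 2).ne'
  have he2t : Real.exp (2 * t) ≤ Real.exp 2 := Real.exp_le_exp.2 (by linarith)
  exact assembly_arith hv2 le_rfl hN' hC₀.le hG₂ (sum_nonneg fun z _ => sq_nonneg _) hAQle (Real.exp_pos _).le he2t hAle hB0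
    hμ₁pos hαsp (B1.aSeq_pos ha hL1 hk1).le (B1.aSeq_le ha hL1 k hk1) hmsp hBle (Real.exp_pos _).le hKtpos.le hF0

end Assembly

/-- **C2 p. 263 / [I] p. 326 / [6] (1.10): THE SUP-NORM DECAY OF THE REGION NEUMANN PROPAGATORS `G_k(Ω,u)` AT SMALL NON-FLAT FIELDS,
`k`-UNIFORM, IN OPERATOR FORM, AT DEEP ROWS** (the VALUE member of [Balaban1983RegularityDecay] (1.10) for p31's `G_k(Ω,u) = gBox
(α_kL^{kD}) ε⁻¹ u k Ω` on a GENERAL union `Ω` of `k`-blocks of the fine torus, `D = d + 1 ≤ 3`, `L = ℓ + 1` odd): there are `t₀, c₀ > 0`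
depending on `d, ℓ, a` only such that for every volume, every `1 ≤ k ≤ K` with `4L^k + 6 ≤ |T|`, every block union `Ω`, every `U(1)` field
bondwise small INSIDE `Ω` (`|u_b − 1| ≤ T` on the in-block bonds of `Ω*`, `|u(Γ^{(k)}_{x_k,x}) − 1| ≤ δ` on `Ω`, `2(L^k−1)L^k·D·T² + 2δ² ≤
1/2` — p34's hypotheses), every `x` whose sup-ball of radius `2L^k + 1` lies in `Ω` ([6]: `dist(x, Ω^c) ≥ R₀`) and every source `f` with
`|f| ≤ F` vanishing at `ℓ^∞`-distance `< D₀` from `x`: `|(G_k(Ω,u)f)(x)| ≤ c₀(L^kε)²e^{−t₀D₀/L^k}F`.  C2 p. 263: *"a straightforward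
application of the random walk expansion of [6] shows that |(G_{k,loc}(u)f)(x)| ≦ ce^{−c dist(suppt f,x)}‖f‖_∞ (2.30)"* — here by Kato's
inequality on the region, p34's free Neumann Laplacian of the region with its comparison principle, the companion deep-row tilted row, and
p34's weighted `ℓ²` (Agmon) bound on the region. [cite: BalabanImbrieJaffe1988, (2.30) p.263] -/
theorem decay110_smallField_region_deep (d ℓ : ℕ) (hd3 : d + 1 ≤ 3) (hℓ : 1 ≤ ℓ) (hodd : Odd (ℓ + 1)) {a : ℝ} (ha : 0 < a) :
    ∃ t₀ c₀ : ℝ, 0 < t₀ ∧ 0 < c₀ ∧ ∀ (P : Params), P.d = d + 1 → P.L = ℓ + 1 →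
      ∀ k : ℕ, 1 ≤ k → k ≤ P.K → 4 * P.L ^ k + 6 ≤ P.sitesPerDir 0 →
      ∀ (Ω : Finset (Balaban1983to89.Site P 0)), IsBlockUnion k Ω →
        ∀ (U : GaugeField P 0 U1) (T δ : ℝ),
          (∀ b ∈ starB Ω, blkIter k b.src = blkIter k b.tgt → ‖toC (U b) - 1‖ ≤ T) →
          (∀ y ∈ Ω, ‖holCK U k y - 1‖ ≤ δ) →
          2 * (((P.L : ℝ) ^ k - 1) * (P.L : ℝ) ^ k) * P.d * T ^ 2 + 2 * δ ^ 2 ≤ 1 / 2 →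
          ∀ (x : Balaban1983to89.Site P 0), (∀ z, supDist x z ≤ 2 * P.L ^ k + 1 → z ∈ Ω) →
          ∀ (f : Balaban1983to89.Site P 0 → ℂ) (F D₀ : ℝ),
            (∀ z, ‖f z‖ ≤ F) → (∀ z, f z ≠ 0 → D₀ ≤ (supDist x z : ℝ)) →
            ‖(gBox (B1RG242Torus.α P a k * (P.L : ℝ) ^ (k * P.d)) P.eps⁻¹ U k Ω *ᵥ f) x‖
              ≤ c₀ * P.spacing k ^ 2 * Real.exp (-(t₀ * D₀ / (P.L : ℝ) ^ k)) * F := by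
  obtain ⟨t₁, C₀, ht₁, hC₀, hR⟩ := tilted_row_regionR_sq_le_deep (d + 1) (ℓ + 1) (by omega) hd3 ⟨hodd, by omega⟩
  obtain ⟨t₀, c₀, ht₀, hc₀, h⟩ := decay110_smallField_region_row d ha ht₁ hC₀
  refine ⟨t₀, c₀, ht₀, hc₀, ?_⟩
  intro P hPd hPL k hk1 hkK hfit Ω hΩ U T δ hInt hTree hsmall x hdeep f F D₀ hF hsupp
  exact h P hPd k hk1 (hkK.trans (Nat.le_add_left _ _)) Ω hΩ U T δ hInt hTree hsmall x
    (fun t ht0 ht1 => hR P hPd hPL k hk1 hkK hfit Ω x hdeep t ht0 ht1) f F D₀ hF hsupp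

/-! ## §2 Corollaries: p31's displayed hypothesis (H1.10) in binder shape, and the bound in every gauge -/

section Corollaries

open B3Bound323ZeroTorus (T_eq_supDist)
open BIJ88DeltaLoc234Torus (mulOp gBox_gaugeAct)
open GaugeField (gaugeAct)

/-- **(H1.10) FOR A GENERAL BLOCK UNION `Ω`, NON-FLAT SMALL `u`, DEEP ROWS — IN THE BINDER SHAPE OF p31's `BIJ88DeltaLocClose235General`**
(`∀ x f F D, (∀ y, ‖f y‖ ≤ F) → (∀ y, f y ≠ 0 → D ≤ T(x,y)) → ‖(G_k(Ω,u)f)(x)‖ ≤ (L^kε)²·(c₀e^{−δ₀D/L^k}F)` with the torus sup-distance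
`T = B5Ineq137Torus.T P 0`, here for the rows `x` with `B_∞(x, 2L^k+1) ⊆ Ω`): the theorem above with `T(x,y) = |x − y|_∞`
(`B3Bound323ZeroTorus.T_eq_supDist`) and the factors reordered.  [6] (1.10) p. 573: *"|(G_k(Ω, A)f)(x)| ≤ c₀exp(−δ₀ dist(x, supp f))‖f‖_∞"*
for *"dist({x,x′}, Ω^c) ≥ R₀"*. [cite: Balaban1983RegularityDecay, (1.10) p.573] -/
theorem decay110_smallField_region_deep_input (d ℓ : ℕ) (hd3 : d + 1 ≤ 3) (hℓ : 1 ≤ ℓ) (hodd : Odd (ℓ + 1)) {a : ℝ} (ha : 0 < a) :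
    ∃ δ₀ c₀ : ℝ, 0 < δ₀ ∧ 0 < c₀ ∧ ∀ (P : Params), P.d = d + 1 → P.L = ℓ + 1 →
      ∀ k : ℕ, 1 ≤ k → k ≤ P.K → 4 * P.L ^ k + 6 ≤ P.sitesPerDir 0 →
      ∀ (Ω : Finset (Balaban1983to89.Site P 0)), IsBlockUnion k Ω →
        ∀ (U : GaugeField P 0 U1) (T δ : ℝ),
          (∀ b ∈ starB Ω, blkIter k b.src = blkIter k b.tgt → ‖toC (U b) - 1‖ ≤ T) →
          (∀ y ∈ Ω, ‖holCK U k y - 1‖ ≤ δ) →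
          2 * (((P.L : ℝ) ^ k - 1) * (P.L : ℝ) ^ k) * P.d * T ^ 2 + 2 * δ ^ 2 ≤ 1 / 2 →
          ∀ (x : Balaban1983to89.Site P 0), (∀ z, supDist x z ≤ 2 * P.L ^ k + 1 → z ∈ Ω) →
          ∀ (f : Balaban1983to89.Site P 0 → ℂ) (F D : ℝ), (∀ y, ‖f y‖ ≤ F) →
            (∀ y, f y ≠ 0 → D ≤ B5Ineq137Torus.T P 0 x y) →
            ‖(gBox (B1RG242Torus.α P a k * (P.L : ℝ) ^ (k * P.d)) P.eps⁻¹ U k Ω *ᵥ f) x‖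
              ≤ P.spacing k ^ 2 * (c₀ * Real.exp (-(δ₀ * (((P.L : ℝ) ^ k)⁻¹ * D))) * F) := by
  obtain ⟨t₀, c₀, ht₀, hc₀, h⟩ := decay110_smallField_region_deep d ℓ hd3 hℓ hodd ha
  refine ⟨t₀, c₀, ht₀, hc₀, ?_⟩
  intro P hPd hPL k hk1 hkK hfit Ω hΩ U T δ hInt hTree hsmall x hdeep f F D hF hsupp
  have hsupp' : ∀ z, f z ≠ 0 → D ≤ (supDist x z : ℝ) := fun z hz => by rw [← T_eq_supDist]; exact hsupp z hz
  have hmain := h P hPd hPL k hk1 hkK hfit Ω hΩ U T δ hInt hTree hsmall x hdeep f F D hF hsupp'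
  have e : t₀ * D / (P.L : ℝ) ^ k = t₀ * (((P.L : ℝ) ^ k)⁻¹ * D) := by rw [div_eq_mul_inv]; ring
  rw [e] at hmain
  calc _ ≤ _ := hmain
    _ = _ := by ring

/-- **THE BOUND IN EVERY GAUGE**: `G_k(Ω,u^h) = M_hG_k(Ω,u)M_hᴴ` (p31 `BIJ88DeltaLoc234Torus.gBox_gaugeAct`, [I] (6.3.2)) and `M_hᴴf` has
the modulus and the support of `f`, so `G_k(Ω,u^h)` obeys the bound of `decay110_smallField_region_deep_input` for EVERY gauge transformation
`h` — the small-field conditions need only hold for a gauge-equivalent field ([I] p. 326: *"under the restriction (7.3.1) on the gauge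
field"*, a restriction on the orbit). [cite: BalabanImbrieJaffe1985, (6.3.2) p.320] -/
theorem decay110_smallField_region_deep_gaugeAct (d ℓ : ℕ) (hd3 : d + 1 ≤ 3) (hℓ : 1 ≤ ℓ) (hodd : Odd (ℓ + 1)) {a : ℝ} (ha : 0 < a) :
    ∃ δ₀ c₀ : ℝ, 0 < δ₀ ∧ 0 < c₀ ∧ ∀ (P : Params), P.d = d + 1 → P.L = ℓ + 1 →
      ∀ k : ℕ, 1 ≤ k → k ≤ P.K → 4 * P.L ^ k + 6 ≤ P.sitesPerDir 0 →
      ∀ (Ω : Finset (Balaban1983to89.Site P 0)), IsBlockUnion k Ω →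
        ∀ (U : GaugeField P 0 U1) (T δ : ℝ),
          (∀ b ∈ starB Ω, blkIter k b.src = blkIter k b.tgt → ‖toC (U b) - 1‖ ≤ T) →
          (∀ y ∈ Ω, ‖holCK U k y - 1‖ ≤ δ) →
          2 * (((P.L : ℝ) ^ k - 1) * (P.L : ℝ) ^ k) * P.d * T ^ 2 + 2 * δ ^ 2 ≤ 1 / 2 →
          ∀ (h : GaugeTransf P 0 U1) (x : Balaban1983to89.Site P 0), (∀ z, supDist x z ≤ 2 * P.L ^ k + 1 → z ∈ Ω) →
          ∀ (f : Balaban1983to89.Site P 0 → ℂ) (F D : ℝ), (∀ y, ‖f y‖ ≤ F) →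
            (∀ y, f y ≠ 0 → D ≤ B5Ineq137Torus.T P 0 x y) →
            ‖(gBox (B1RG242Torus.α P a k * (P.L : ℝ) ^ (k * P.d)) P.eps⁻¹ (gaugeAct h U) k Ω *ᵥ f) x‖
              ≤ P.spacing k ^ 2 * (c₀ * Real.exp (-(δ₀ * (((P.L : ℝ) ^ k)⁻¹ * D))) * F) := by
  obtain ⟨t₀, c₀, ht₀, hc₀, hmain⟩ := decay110_smallField_region_deep_input d ℓ hd3 hℓ hodd ha
  refine ⟨t₀, c₀, ht₀, hc₀, ?_⟩
  intro P hPd hPL k hk1 hkK hfit Ω hΩ U T δ hInt hTree hsmall h x hdeep f F D hF hsupp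
  have hk0 : 0 + k ≤ P.m + P.K := by omega
  have hL1 : (1 : ℝ) < P.L := B1RG242Torus.one_lt_cast_L P
  have ha' : 0 < B1RG242Torus.α P a k * (P.L : ℝ) ^ (k * P.d) :=
    mul_pos (mul_pos (B1.aSeq_pos ha hL1 hk1) (inv_pos.2 (pow_pos (P.spacing_pos k) 2))) (pow_pos P.cast_L_pos _)
  have hc' : P.eps⁻¹ ≠ 0 := inv_ne_zero P.eps_pos.ne'
  have hmo : ∀ (w : Balaban1983to89.Site P 0 → ℂ) (z : Balaban1983to89.Site P 0), (mulOp h *ᵥ w) z = toC (h z) * w z :=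
    fun w z => by simp only [mulOp, mulVec_diagonal]
  have hg : ∀ z : Balaban1983to89.Site P 0, ((mulOp h)ᴴ *ᵥ f) z = star (toC (h z)) * f z := fun z => by
    simp only [mulOp, diagonal_conjTranspose, mulVec_diagonal, Pi.star_apply]
  rw [gBox_gaugeAct hk0 hc' ha' h U hΩ, ← mulVec_mulVec, ← mulVec_mulVec, hmo, norm_mul, norm_toC, one_mul]
  refine hmain P hPd hPL k hk1 hkK hfit Ω hΩ U T δ hInt hTree hsmall x hdeep _ F D (fun y => ?_) (fun y hy => hsupp y ?_)
  · rw [hg, norm_mul, norm_star, norm_toC, one_mul]; exact hF y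
  · intro hf
    exact hy (by rw [hg, hf, mul_zero])

end Corollaries

/-! ## §3 The bound under the PRINTED hypothesis (7.3.1) — small plaquette variables, NO gauge condition — with a threshold depending on
`(d, L^k)` only: the blockwise centred gauge (p27 gen 34 §7, region version) -/

section Uniform

open BIJ88DeltaLoc234Torus (mulOp gBox_gaugeAct conjTranspose_mul_mulOp)
open GaugeField (gaugeAct plaqHol)
open BIJ88NeumannPropagatorSmallPlaquetteRegion (holCK_congr)
open BIJ85CentredAxialGauge (centredGauge dist1_centredGauge_le)
open BIJ85HolonomyDeviation (norm_holCK_sub_one_le)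
open BIJ88Smooth43Axial (dist1_eq_norm_toC_sub_one)
open BIJ88Sect3Statements (toC_one)
open BIJ85ScalarPropagatorDecay (supDist_le_of_blkIter_eq)

/-- **THE `k`-UNIFORM OPERATOR-FORM BOUND FOR `G_k(Ω,u)` AT DEEP ROWS UNDER THE PRINTED HYPOTHESIS (7.3.1) WITH A THRESHOLD DEPENDING ON
`(d, L^k)` ONLY** — uniform in the block union `Ω`, in the volume and in the field: there are `δ₀, c₀ > 0` depending on `(d, ℓ, a)` only such
that for every volume with `P.d = d + 1 ≤ 3`, `P.L = ℓ + 1` odd and `4L^k + 6 ≤ |T|`, every `1 ≤ k ≤ K`, every `U(1)` field with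
`|u(∂p) − 1| ≤ θ` for all plaquettes, every `T ≥ d(L^k − 1)θ` (`d = P.d − 1`) with `2(L^k−1)L^k(d+1)T² + 2((d+1)(L^k−1)T)² ≤ 1/2`, every
union `Ω` of `k`-blocks, every `x` with `B_∞(x, 2L^k+1) ⊆ Ω` and every `f` with `‖f‖_∞ ≤ F` vanishing on `{T(x,·) < D}`:
`‖(G_k(Ω,u)f)(x)‖ ≤ (L^kε)²·c₀e^{−δ₀D/L^k}F`.  PROOF (gen 34 §7 verbatim, the cube replaced by `Ω`): the engine's hypotheses (§1) are
BLOCK-LOCAL, so the change of gauge of [I] p. 326 is made block by block — `h(z) =` p30's centred axial gauge of the `k`-block of `z`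
(`dist1_centredGauge_le`): on every bond with both ends in one `k`-block `|u^h(b) − 1| ≤ d(L^k − 1)θ ≤ T`; the composite transport
`u^h(Γ^{(k)}_y)` reads only such bonds (p34 `holCK_congr`), so `|u^h(Γ^{(k)}_y) − 1| ≤ (d+1)(L^k − 1)T` (p33 `norm_holCK_sub_one_le`); §2's
`decay110_smallField_region_deep_input` for `u^h` and the source `M_hf`, and `G_k(Ω,u) = M_hᴴG_k(Ω,u^h)M_h` (p31 `gBox_gaugeAct`).  [I] p. 326:
*"The propagators arising from Δ_k(u_k), under the restriction (7.3.1) on the gauge field, also satisfy the regularity and decay estimates of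
[7]."* [cite: BalabanImbrieJaffe1985, (7.3.1)–(7.3.2) p.326] -/
theorem decay110_smallPlaquette_region_deep_uniform (d ℓ : ℕ) (hd3 : d + 1 ≤ 3) (hℓ : 1 ≤ ℓ) (hodd : Odd (ℓ + 1)) {a : ℝ} (ha : 0 < a) :
    ∃ δ₀ c₀ : ℝ, 0 < δ₀ ∧ 0 < c₀ ∧ ∀ (P : Params), P.d = d + 1 → P.L = ℓ + 1 →
      ∀ k : ℕ, 1 ≤ k → k ≤ P.K → 4 * P.L ^ k + 6 ≤ P.sitesPerDir 0 →
      ∀ (U : GaugeField P 0 U1) (θ : ℝ), 0 ≤ θ → (∀ p : Balaban1983to89.Plaq P 0, ‖toC (plaqHol U p) - 1‖ ≤ θ) →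
        ∀ (T : ℝ), ((P.d - 1 : ℕ) : ℝ) * ((P.L : ℝ) ^ k - 1) * θ ≤ T →
          2 * (((P.L : ℝ) ^ k - 1) * (P.L : ℝ) ^ k) * P.d * T ^ 2 + 2 * (P.d * ((P.L : ℝ) ^ k - 1) * T) ^ 2 ≤ 1 / 2 →
        ∀ (Ω : Finset (Balaban1983to89.Site P 0)), IsBlockUnion k Ω →
          ∀ (x : Balaban1983to89.Site P 0), (∀ z, supDist x z ≤ 2 * P.L ^ k + 1 → z ∈ Ω) →
          ∀ (f : Balaban1983to89.Site P 0 → ℂ) (F D : ℝ), (∀ y, ‖f y‖ ≤ F) →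
            (∀ y, f y ≠ 0 → D ≤ B5Ineq137Torus.T P 0 x y) →
            ‖(gBox (B1RG242Torus.α P a k * (P.L : ℝ) ^ (k * P.d)) P.eps⁻¹ U k Ω *ᵥ f) x‖
              ≤ P.spacing k ^ 2 * (c₀ * Real.exp (-(δ₀ * (((P.L : ℝ) ^ k)⁻¹ * D))) * F) := by
  obtain ⟨δ₀, c₀, hδ₀, hc₀, H⟩ := decay110_smallField_region_deep_input d ℓ hd3 hℓ hodd ha
  refine ⟨δ₀, c₀, hδ₀, hc₀, ?_⟩
  intro P hPd hPL k hk1 hkK hfit U θ hθ hplaq T hT hsmall Ω hΩ x hdeep f F D hF hsupp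
  have hk : k ≤ P.m + P.K := hkK.trans (Nat.le_add_left _ _)
  have hk0 : 0 + k ≤ P.m + P.K := by omega
  have hR : 2 * (P.L ^ k - 1) + 4 < P.sitesPerDir 0 := by
    have h1 : 1 ≤ P.L ^ k := Nat.one_le_pow _ _ P.L_pos
    omega
  have hL1 : (1 : ℝ) < P.L := B1RG242Torus.one_lt_cast_L P
  have ha' : 0 < B1RG242Torus.α P a k * (P.L : ℝ) ^ (k * P.d) :=
    mul_pos (mul_pos (B1.aSeq_pos ha hL1 hk1) (inv_pos.2 (pow_pos (P.spacing_pos k) 2))) (pow_pos P.cast_L_pos _)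
  have hc' : P.eps⁻¹ ≠ 0 := inv_ne_zero P.eps_pos.ne'
  have hT0 : 0 ≤ T := by
    refine le_trans (mul_nonneg (mul_nonneg (Nat.cast_nonneg _) ?_) hθ) hT
    have : (1 : ℝ) ≤ (P.L : ℝ) ^ k := one_le_pow₀ hL1.le
    linarith
  have hplaq' : ∀ p : Balaban1983to89.Plaq P 0, dist1 (plaqHol U p) ≤ θ := fun p => by
    rw [dist1_eq_norm_toC_sub_one]; exact hplaq p
  -- the blockwise centred gauge: on the `k`-block of `z`, p30's centred axial gauge of that block (centre its corner, radius `L^k − 1`)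
  set Rb : ℕ := P.L ^ k - 1 with hRbdef
  set h : GaugeTransf P 0 U1 := fun z => centredGauge U (cornerIter k (blkIter k z)) Rb z with hh
  have hcast : ((Rb : ℕ) : ℝ) = (P.L : ℝ) ^ k - 1 := by
    rw [hRbdef, Nat.cast_sub (Nat.one_le_pow _ _ P.L_pos), Nat.cast_pow, Nat.cast_one]
  -- every bond with both ends in one `k`-block is `T`-small for `u^h`
  have hbond : ∀ b : PBond P 0, blkIter k b.src = blkIter k b.tgt → ‖toC (gaugeAct h U b) - 1‖ ≤ T := by
    intro b hb
    set x₀ : Balaban1983to89.Site P 0 := cornerIter k (blkIter k b.src) with hx₀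
    have e : gaugeAct h U b = gaugeAct (centredGauge U x₀ Rb) U ⟨b.src, b.dir⟩ := by
      show h b.src * U b * (h b.tgt)⁻¹ = centredGauge U x₀ Rb b.src * U b * (centredGauge U x₀ Rb b.tgt)⁻¹
      simp only [hh, hx₀, hb]
    have hz : supDist x₀ b.src ≤ Rb :=
      supDist_le_of_blkIter_eq hk0 (by rw [hx₀, blkIter_cornerIter k hk0])
    have h2 := dist1_centredGauge_le U hθ hplaq' x₀ hR b.src hz b.dir
    rw [dist1_eq_norm_toC_sub_one] at h2
    rw [e]
    refine h2.trans (le_trans ?_ hT)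
    have hz' : (supDist x₀ b.src : ℝ) ≤ (P.L : ℝ) ^ k - 1 := by rw [← hcast]; exact_mod_cast hz
    exact mul_le_mul_of_nonneg_right (mul_le_mul_of_nonneg_left hz' (Nat.cast_nonneg _)) hθ
  -- the composite transports of `u^h` read only intra-block bonds
  have htree : ∀ y : Balaban1983to89.Site P 0, ‖holCK (gaugeAct h U) k y - 1‖ ≤ P.d * ((P.L : ℝ) ^ k - 1) * T := by
    intro y
    set V : GaugeField P 0 U1 := fun b => if blkIter k b.src = blkIter k b.tgt then gaugeAct h U b else 1 with hV
    have hVb : ∀ b : PBond P 0, ‖toC (V b) - 1‖ ≤ T := fun b => by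
      by_cases hb : blkIter k b.src = blkIter k b.tgt
      · have h1 : V b = gaugeAct h U b := by simp only [hV]; exact if_pos hb
        rw [h1]; exact hbond b hb
      · have h1 : V b = 1 := by simp only [hV]; exact if_neg hb
        rw [h1, toC_one, sub_self, norm_zero]; exact hT0
    have hcongr : holCK (gaugeAct h U) k y = holCK V k y :=
      holCK_congr k hk0 y fun b hb1 hb2 => by
        have h1 : V b = gaugeAct h U b := by simp only [hV]; exact if_pos (hb1.trans hb2.symm)
        rw [h1]
    rw [hcongr]
    exact norm_holCK_sub_one_le hT0 hVb k y
  -- `G_k(Ω,u) = M_hᴴ·G_k(Ω,u^h)·M_h`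
  have hGU : gBox (B1RG242Torus.α P a k * (P.L : ℝ) ^ (k * P.d)) P.eps⁻¹ U k Ω =
      (mulOp h)ᴴ * gBox (B1RG242Torus.α P a k * (P.L : ℝ) ^ (k * P.d)) P.eps⁻¹ (gaugeAct h U) k Ω * mulOp h := by
    rw [gBox_gaugeAct hk0 hc' ha' h U hΩ, Matrix.mul_assoc, Matrix.mul_assoc, Matrix.mul_assoc, conjTranspose_mul_mulOp,
      Matrix.mul_one, ← Matrix.mul_assoc, conjTranspose_mul_mulOp, Matrix.one_mul]
  have hmo : ∀ (w : Balaban1983to89.Site P 0 → ℂ) (z : Balaban1983to89.Site P 0), (mulOp h *ᵥ w) z = toC (h z) * w z :=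
    fun w z => by simp only [mulOp, mulVec_diagonal]
  have hmoH : ∀ (w : Balaban1983to89.Site P 0 → ℂ) (z : Balaban1983to89.Site P 0), ((mulOp h)ᴴ *ᵥ w) z = star (toC (h z)) * w z :=
    fun w z => by simp only [mulOp, diagonal_conjTranspose, mulVec_diagonal, Pi.star_apply]
  rw [hGU, ← mulVec_mulVec, ← mulVec_mulVec, hmoH, norm_mul, norm_star, norm_toC, one_mul]
  refine H P hPd hPL k hk1 hkK hfit Ω hΩ (gaugeAct h U) T (P.d * ((P.L : ℝ) ^ k - 1) * T) (fun b _ hb => hbond b hb)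
    (fun z _ => htree z) hsmall x hdeep _ F D (fun y => ?_) (fun y hy => hsupp y ?_)
  · rw [hmo, norm_mul, norm_toC, one_mul]; exact hF y
  · intro hf
    exact hy (by rw [hmo, hf, mul_zero])

end Uniform

end

end Literature.MathematicalPhysics.QuantumFieldTheory.BalabanImbrieJaffe1984to88.BIJ88NeumannPropagatorSmallFieldRegionSupDecayDeep
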